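import Mathlib
import Summits.NavierStokesRegularity.OSWSelfSimilar.TypeIIInnerLimitEveryLimitDatum
import Summits.NavierStokesRegularity.OSWSelfSimilar.TypeIIInnerLimitCaseAStanding
import Summits.NavierStokesRegularity.NavierStokesRegularity.Theorems.CertifiedBlowupCertifiedBlowupAxisymBlowupZoomExtract
import Summits.NavierStokesRegularity.NavierStokesRegularity.Theorems.CertifiedBlowupCertifiedBlowupAxisymBlowupZoomSelection
import Summits.NavierStokesRegularity.NavierStokesRegularity.Theorems.CertifiedBlowupCertifiedBlowupAxisymBlowupZoomWindowLipschitz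
import Summits.NavierStokesRegularity.NavierStokesRegularity.Theorems.CertifiedBlowupCertifiedBlowupAxisymBlowupZoomRescaleCompare
import Literature.Analysis.FluidPDE.KNSSTypeIRateLiouvilleMild
import Literature.Analysis.FluidPDE.LeiZhang2017AxisymmetricCriteria
import HarnessLib

/-!
# Registered stub `zoom_dichotomy_of_isMaximalSmoothSolution` of the crux `CertifiedBlowupAxisymBlowup`

Theorems file landed `--supports stmt-NavierStokesRegularity-0727`, sub-skeleton "axis-aware KNSS sup-zoom of a witness"
(`Cruxes/CertifiedBlowupAxisymBlowup/Lines/registered_zoom_probe.lean`); the stub is stated VERBATIM (hence the registered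
local notation `ℝ³`). For a maximal smooth solution (`ν = 1`, lifespan `T > 0`), Leray–Hopf from a rapidly decaying
axisymmetric datum: meridional near-max points `(tₙ, xₙ)` with `‖u(tₙ,xₙ)‖ → ∞`, `sup_{(0,tₙ]} ‖u‖ ≤ (1 + 1/(n+1))‖u(tₙ,xₙ)‖`;
the KNSS sup-zoom at `(tₙ, xₙ)` converges slice-wise locally uniformly to a bounded ancient mild `W`, `|W| ≤ 1`,
`1 − L|s| ≤ ‖W(s,0)‖`; and EITHER `W ≡ b` (`‖b‖ = 1`) OR a translate `W(s, · − de₀)` (`d ≥ 0`) is axisymmetric with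
`|Γ| ≤ ⨆_z|Γ(u₀)(z)|` and not swirl-free. ASSEMBLY of tree theorems: `zoom_nearMax_gamma` at levels forcing `tₙ > T/2` and
window depth `≤ −3`; meridional representative (`exists_rotZ_eq_meridional`); zone-Z1 `zoom_isClassical` / `zoom_oseenMild`;
`zoom_window_lipschitz` (shifted: `windowLipschitz_shift`); `zoom_extract`; `isBoundedAncientMildSolution_of_oseen`; the
DICHOTOMY from the zone-Z1 every-limit theorem `innerLimit_alternative_of_every_zoom_limit_datum` (`ν = 1`) on the sup-gauge
scale `λₙ/γₙ`, whose limit is identified with `W` pointwise (`zoom_rescale_compare`, `γₙ → 1`). (AX-L) is NOT assumed.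
No definitions, no named-fact hypotheses, no `sorry`. WHAT THIS IS NOT: not a blow-up or regularity claim — statements
about the zoom of a HYPOTHETICAL witness. Cell `ns-blowup`, zone Z1 (profile-eng-1 g9). Reference: Koch–Nadirashvili–
Seregin–Šverák, Acta Math. 203 (2009), §4, §6. [KochNadirashviliSereginSverak2009]
-/

set_option linter.dupNamespace false

noncomputable section

open MeasureTheory Set Function Filter Topology Metric
open scoped NNReal ENNReal

namespace Summit.NavierStokesRegularity.NavierStokesRegularity.Theorems.CertifiedBlowupAxisymBlowup.CompactAmplification

open Literature.Analysis Literature.Analysis.FluidPDE Literature.Analysis.UnboundedOperators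
open Summit.NavierStokesRegularity.NavierStokesRegularity.Theses.CertifiedBlowup
open Summit.NavierStokesRegularity.OSWSelfSimilar.TypeIIModulationDictionary

local notation "ℝ³" => EuclideanSpace ℝ (Fin 3)

/-- **The registered zoom dichotomy, from a space–time Lipschitz modulus `L` of bounded Oseen-mild windows** (the
conclusion of `zoom_window_lipschitz` taken as a hypothesis; see the module docstring for the assembly).
[cite: KochNadirashviliSereginSverak2009, §6 Prop. 6.1 / Lemma 6.1 with §4] -/
theorem zoom_dichotomy_core {L : ℝ} (hL0 : 0 ≤ L)
    (hL : (∀ (V : ℝ → ℝ³ → ℝ³) (A B : ℝ), A ≤ -3 → 0 < B →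
      ContinuousOn (uncurry V) (Ioo A B ×ˢ univ) → (∀ s ∈ Ioc A 0, ∀ y, ‖V s y‖ ≤ 2) →
      (∀ s ∈ Ioo A B, IsWeaklyDivFree (V s)) →
      (∀ s t : ℝ, A < s → s < t → t ≤ 0 → ∀ x, V t x = heatExtension (V s) (t - s) x - oseenDuhamel 1 s V V t x) →
      ∀ s ∈ Icc (-1 : ℝ) 0, ∀ t ∈ Icc (-1 : ℝ) 0, ∀ x y : ℝ³, ‖V t x - V s y‖ ≤ L * (|t - s| + ‖x - y‖))) :
    ∀ {T : ℝ} {u : ℝ → ℝ³ → ℝ³} {p : ℝ → ℝ³ → ℝ}, 0 < T → IsMaximalSmoothSolution 1 0 u p T →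
    IsLerayHopfOn T 1 0 (u 0) u → HasRapidSpatialDecay (u 0) → IsAxisymmetric (u 0) →
    ∃ (t : ℕ → ℝ) (x : ℕ → ℝ³) (W : ℝ → ℝ³ → ℝ³), (∀ n, t n ∈ Ioo 0 T) ∧ (∀ n, x n 1 = 0 ∧ 0 ≤ x n 0) ∧
      Tendsto (fun n => ‖u (t n) (x n)‖) atTop atTop ∧
      (∀ n, ∀ s ∈ Ioc 0 (t n), ∀ y, ‖u s y‖ ≤ (1 + 1 / ((n : ℝ) + 1)) * ‖u (t n) (x n)‖) ∧
      ContinuousOn (uncurry W) (Iio 0 ×ˢ univ) ∧ (∀ s < 0, ∀ y, ‖W s y‖ ≤ 1) ∧ IsBoundedAncientMildSolution 1 W ∧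
      (∃ L : ℝ, ∀ s ∈ Ioo (-1 : ℝ) 0, 1 - L * |s| ≤ ‖W s 0‖) ∧
      (∀ s < 0, TendstoLocallyUniformly (fun n (y : ℝ³) => ‖u (t n) (x n)‖⁻¹ •
        u (t n + ‖u (t n) (x n)‖⁻¹ ^ 2 * s) (x n + ‖u (t n) (x n)‖⁻¹ • y)) (W s) atTop) ∧
      ((∃ b : ℝ³, ‖b‖ = 1 ∧ ∀ s < 0, ∀ y, W s y = b) ∨
        (∃ d : ℝ, 0 ≤ d ∧ (∀ s < 0, IsAxisymmetric fun y => W s (y - d • EuclideanSpace.single 0 1)) ∧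
          (∀ s < 0, ∀ y, |swirl (fun y => W s (y - d • EuclideanSpace.single 0 1)) y| ≤ ⨆ z, |swirl (u 0) z|) ∧
          ¬ ∀ s < 0, HasNoSwirl fun y => W s (y - d • EuclideanSpace.single 0 1))) := by
  intro T u p hT hmax hLH hdec haxi
  -- ### standing facts for the witness (ν = 1)
  have hcl := hmax.1
  have haxiI := isAxisymmetric_slice_of_lerayHopf_classical one_pos hcl hLH hdec haxi
  have hbddI := bounded_before_of_lerayHopf_classical one_pos hcl hLH hdec haxi
  have hbdd : ∀ S < T, ∃ N : ℝ, 0 < N ∧ ∀ t ∈ Icc 0 S, ∀ x, ‖u t x‖ ≤ N := fun S hS => by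
    obtain ⟨M, hM⟩ := hbddI S hS
    exact ⟨max M 1, lt_max_of_lt_right one_pos, fun t ht x => (hM t ht x).trans (le_max_left _ _)⟩
  have hE := energyBound_of_lerayHopf hLH
  have hunb := unbounded_of_not_hasSmoothExtensionPast hT hcl hLH hmax.2
  obtain ⟨Mₛ, hMₛ'⟩ := hdec.abs_swirl_le
  have hswBdd : BddAbove (Set.range fun z => |swirl (u 0) z|) := ⟨Mₛ, by rintro _ ⟨z, rfl⟩; exact hMₛ' z⟩
  have hMₛ : ∀ z, |swirl (u 0) z| ≤ ⨆ z, |swirl (u 0) z| := fun z => le_ciSup hswBdd z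
  -- ### inputs of the near-max selection
  have hbdd' : ∀ T' < T, ∃ M : ℝ, ∀ t ∈ Ioo 0 T', ∀ x, ‖u t x‖ ≤ M := fun T' hT' => by
    obtain ⟨M, hM⟩ := hbddI T' hT'
    exact ⟨M, fun t ht x => hM t ⟨ht.1.le, ht.2.le⟩ x⟩
  obtain ⟨M₁, hM₁⟩ := hbddI (T / 2) (by linarith)
  obtain ⟨M₀, hM₀⟩ := hbddI 0 hT
  have hunb' : ¬ ∃ M : ℝ, ∀ t ∈ Ioo 0 T, ∀ x, ‖u t x‖ ≤ M := by
    rintro ⟨M, hM⟩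
    obtain ⟨t, ht, x, hx⟩ := hunb (max M M₀)
    rcases eq_or_lt_of_le ht.1 with h0 | h0
    · have h := hM₀ t ⟨ht.1, h0.symm.le⟩ x
      linarith [le_max_right M M₀]
    · have h := hM t ⟨h0, ht.2⟩ x
      linarith [le_max_left M M₀]
  -- ### the selection at level `n`
  set R : ℕ → ℝ := fun n => max ((n : ℝ) + 1) (max (M₁ + 1) (Real.sqrt (6 / T) + 1)) with hR
  set γ : ℕ → ℝ := fun n => 1 + 1 / ((n : ℝ) + 1) with hγ
  have hγ1 : ∀ n, 1 < γ n := fun n => by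
    have : (0 : ℝ) < 1 / ((n : ℝ) + 1) := by positivity
    simp only [hγ]; linarith
  have hγ2 : ∀ n, γ n ≤ 2 := fun n => by
    have : 1 / ((n : ℝ) + 1) ≤ 1 := by
      rw [div_le_one (by positivity)]; linarith [(Nat.cast_nonneg n : (0 : ℝ) ≤ n)]
    simp only [hγ]; linarith
  have hγlim : Tendsto γ atTop (𝓝 1) := by
    have h := (tendsto_one_div_add_atTop_nhds_zero_nat (𝕜 := ℝ)).const_add 1
    simpa [hγ] using h
  choose t ht x₀ hRlt hnear₀ using fun n : ℕ => zoom_nearMax_gamma hbdd' hunb' (R n) (γ n) (hγ1 n)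
  choose θ hθ using fun n => exists_rotZ_eq_meridional (x₀ n)
  set x : ℕ → ℝ³ := fun n => EuclideanSpace.single 0 (cylRadius (x₀ n)) + EuclideanSpace.single 2 (x₀ n 2) with hx
  have htI : ∀ n, t n ∈ Ico 0 T := fun n => ⟨(ht n).1.le, (ht n).2⟩
  have hxeq : ∀ n, ‖u (t n) (x n)‖ = ‖u (t n) (x₀ n)‖ := fun n => by
    rw [hx]
    simp only
    rw [← hθ n, (haxiI (t n) (htI n)).norm_rotZ_apply]
  -- the level `N n = ‖u(t n, x n)‖`
  set N : ℕ → ℝ := fun n => ‖u (t n) (x n)‖ with hN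
  have hNR : ∀ n, R n < N n := fun n => by rw [hN]; simp only; rw [hxeq]; exact hRlt n
  have hNn : ∀ n : ℕ, (n : ℝ) + 1 < N n := fun n => lt_of_le_of_lt (le_max_left _ _) (hNR n)
  have hN0 : ∀ n, 0 < N n := fun n => lt_trans (by positivity) (hNn n)
  have hnear : ∀ n, ∀ s ∈ Ioc 0 (t n), ∀ y, ‖u s y‖ ≤ γ n * N n := fun n s hs y => by
    rw [hN]; simp only; rw [hxeq]; exact hnear₀ n s hs y
  -- `t n > T/2`
  have htn : ∀ n, T / 2 < t n := fun n => by
    by_contra h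
    push Not at h
    have h1 := hM₁ (t n) ⟨(ht n).1.le, h⟩ (x₀ n)
    have h2 : M₁ + 1 ≤ R n := (le_max_left _ _).trans (le_max_right _ _)
    linarith [hRlt n]
  -- ### the zooms `V n = λₙ • stPull λₙ² λₙ tₙ xₙ u`, `λₙ = 1/N n`
  set lam : ℕ → ℝ := fun n => (N n)⁻¹ with hlam
  have hlam0 : ∀ n, 0 < lam n := fun n => inv_pos.2 (hN0 n)
  have hlamN : ∀ n, lam n * N n = 1 := fun n => inv_mul_cancel₀ (hN0 n).ne'
  set A : ℕ → ℝ := fun n => -t n / lam n ^ 2 with hA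
  set B : ℕ → ℝ := fun n => (T - t n) / lam n ^ 2 with hB
  set V : ℕ → ℝ → ℝ³ → ℝ³ := fun n => lam n • stPull (lam n ^ 2) (lam n) (t n) (x n) u with hV
  have hB0 : ∀ n, 0 < B n := fun n => div_pos (sub_pos.2 (ht n).2) (pow_pos (hlam0 n) 2)
  have hAeq : ∀ n, A n = -(t n * N n ^ 2) := fun n => by
    rw [hA, hlam]; simp only; rw [inv_pow, div_inv_eq_mul]; ring
  have hA3 : ∀ n, A n ≤ -3 := fun n => by
    rw [hAeq]
    have h1 : Real.sqrt (6 / T) + 1 ≤ N n :=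
      ((le_max_right _ _).trans (le_max_right _ _)).trans (hNR n).le
    have h2 : Real.sqrt (6 / T) ^ 2 = 6 / T := Real.sq_sqrt (by positivity)
    have h3 : 6 / T ≤ N n ^ 2 := by
      rw [← h2]; exact pow_le_pow_left₀ (Real.sqrt_nonneg _) (by linarith [Real.sqrt_nonneg (6 / T)]) 2
    have h4 : T / 2 * (6 / T) = 3 := by field_simp; ring
    nlinarith [htn n, hN0 n, mul_le_mul_of_nonneg_left h3 (by positivity : (0:ℝ) ≤ T / 2)]
  have hAlim : Tendsto A atTop atBot := by
    have h0 : Tendsto (fun n : ℕ => ((n : ℝ) + 1) ^ 2) atTop atTop :=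
      (tendsto_pow_atTop two_ne_zero).comp (tendsto_natCast_atTop_atTop.atTop_add tendsto_const_nhds)
    have h1 : Tendsto (fun n : ℕ => -(T / 2 * ((n : ℝ) + 1) ^ 2)) atTop atBot :=
      tendsto_neg_atTop_atBot.comp (h0.const_mul_atTop (by positivity))
    refine tendsto_atBot_mono (fun n => ?_) h1
    rw [hAeq]
    have h2 : ((n : ℝ) + 1) ^ 2 ≤ N n ^ 2 := pow_le_pow_left₀ (by positivity) (hNn n).le 2
    nlinarith [htn n, mul_le_mul_of_nonneg_left h2 (by positivity : (0:ℝ) ≤ T / 2), hT]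
  -- ### the zooms satisfy the hypotheses of `zoom_extract`
  have hVcl : ∀ n, IsClassicalNSSolutionOn (Ioo (A n) (B n)) 1 0 (V n)
      (lam n ^ 2 • stPull (lam n ^ 2) (lam n) (t n) (x n) p) := fun n => zoom_isClassical hcl (hlam0 n) (t n) (x n)
  have hVcont : ∀ n, ContinuousOn (uncurry (V n)) (Ioo (A n) (B n) ×ˢ univ) := fun n =>
    (hVcl n).smooth_velocity.continuousOn
  have hVdiv : ∀ n, ∀ s ∈ Ioo (A n) (B n), IsWeaklyDivFree (V n s) := fun n s hs =>
    VectorCalculus.IsDivFree.isWeaklyDivFree_holds ((hVcl n).divFree s hs)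
      (((hVcl n).contDiff_velocity hs).of_le (by norm_cast))
  have hVmild : ∀ n, ∀ s τ : ℝ, A n < s → s < τ → τ ≤ 0 → ∀ y,
      V n τ y = heatExtension (V n s) (τ - s) y - oseenDuhamel 1 s (V n) (V n) τ y :=
    fun n s τ hs hsτ hτ y => zoom_oseenMild hcl hE hbdd (hlam0 n) (t n) (x n) hs hsτ (lt_of_le_of_lt hτ (hB0 n)) y
  have hVbd : ∀ n, ∀ s ∈ Ioc (A n) 0, ∀ y, ‖V n s y‖ ≤ γ n := fun n s hs y => by
    have hl2 : 0 < lam n ^ 2 := pow_pos (hlam0 n) 2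
    have hs1 : 0 < t n + lam n ^ 2 * s := by
      have h := hs.1
      rw [hA] at h; simp only at h
      rw [div_lt_iff₀ hl2] at h
      linarith
    have hs2 : t n + lam n ^ 2 * s ≤ t n := by nlinarith [hs.2]
    have h := hnear n (t n + lam n ^ 2 * s) ⟨hs1, hs2⟩ (x n + lam n • y)
    rw [hV]
    simp only [Pi.smul_apply, stPull_apply, norm_smul, Real.norm_eq_abs, abs_of_pos (hlam0 n)]
    calc lam n * ‖u (t n + lam n ^ 2 * s) (x n + lam n • y)‖ ≤ lam n * (γ n * N n) :=
          mul_le_mul_of_nonneg_left h (hlam0 n).le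
      _ = γ n := by rw [mul_left_comm, hlamN, mul_one]
  have hVone : ∀ n, ‖V n 0 (0 : ℝ³)‖ = 1 := fun n => by
    rw [hV]
    simp only [Pi.smul_apply, stPull_apply, mul_zero, add_zero, smul_zero, norm_smul, Real.norm_eq_abs,
      abs_of_pos (hlam0 n)]
    exact hlamN n
  have hLV : ∀ n, ∀ s ∈ Icc (-1 : ℝ) 0, ∀ τ ∈ Icc (-1 : ℝ) 0, ∀ y z : ℝ³,
      ‖V n τ y - V n s z‖ ≤ L * (|τ - s| + ‖y - z‖) := fun n =>
    hL (V n) (A n) (B n) (hA3 n) (hB0 n) (hVcont n) (fun s hs y => (hVbd n s hs y).trans (hγ2 n)) (hVdiv n)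
      (hVmild n)
  -- ### the extraction (tree `zoom_extract`)
  obtain ⟨φ, W, hφ, hWc, hW1, hWdiv, hWmild, hvertex, hpt, hloc⟩ :=
    zoom_extract A B γ V (fun _ => 0) 0 L hAlim hA3 hB0 hVcont hVdiv hVmild hVbd hγ2 hγlim hVone
      tendsto_const_nhds hL0 hLV
  have hWanc : IsBoundedAncientMildSolution 1 W :=
    isBoundedAncientMildSolution_of_oseen one_pos hWc ⟨1, hW1⟩ hWdiv
      (fun s τ hsτ hτ y => by rw [one_mul]; exact hWmild s τ hsτ hτ y)
  -- ### the sup-gauge scale `λ'ₙ = λₙ/γₙ` for the Z1 dictionary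
  have hγ0 : ∀ n, 0 < γ n := fun n => lt_trans one_pos (hγ1 n)
  set lam' : ℕ → ℝ := fun n => lam n / γ n with hlam'
  have hlam'0 : ∀ n, 0 < lam' n := fun n => div_pos (hlam0 n) (hγ0 n)
  have hlamlim : Tendsto lam atTop (𝓝 0) := by
    refine squeeze_zero (fun n => (hlam0 n).le) (fun n => ?_) (tendsto_one_div_add_atTop_nhds_zero_nat (𝕜 := ℝ))
    rw [hlam]; simp only; rw [one_div]
    exact (inv_lt_inv₀ (hN0 n) (by positivity)).2 (hNn n) |>.le
  have hlam'lim : Tendsto lam' atTop (𝓝 0) :=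
    squeeze_zero (fun n => (hlam'0 n).le) (fun n => div_le_self (hlam0 n).le (hγ1 n).le) hlamlim
  have hlam'N : ∀ n, lam' n * N n = (γ n)⁻¹ := fun n => by
    rw [hlam']; simp only; rw [div_mul_eq_mul_div, hlamN, one_div]
  -- gauge `λ'‖u‖ ≤ 1` on `[0, tₙ]` (at `τ = 0` by continuity from the right)
  have hcont0 : ∀ y : ℝ³, Tendsto (fun σ => ‖u σ y‖) (𝓝[>] 0) (𝓝 ‖u 0 y‖) := fun y => by
    have h1 : ContinuousWithinAt (uncurry u) (Ico 0 T ×ˢ univ) (0, y) :=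
      hcl.smooth_velocity.continuousOn _ ⟨⟨le_rfl, hT⟩, mem_univ _⟩
    have h2 : Tendsto (fun σ : ℝ => (σ, y)) (𝓝[>] 0) (𝓝[Ico 0 T ×ˢ univ] (0, y)) := by
      apply tendsto_nhdsWithin_of_tendsto_nhds_of_eventually_within
      · exact ((continuous_id.prodMk continuous_const).tendsto 0).mono_left nhdsWithin_le_nhds
      · filter_upwards [Ioo_mem_nhdsGT hT] with σ hσ
        exact ⟨⟨hσ.1.le, hσ.2⟩, mem_univ _⟩
    exact (h1.tendsto.comp h2).norm
  have hnear0 : ∀ n, ∀ τ ∈ Icc 0 (t n), ∀ y, ‖u τ y‖ ≤ γ n * N n := fun n τ hτ y => by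
    rcases eq_or_lt_of_le hτ.1 with h0 | h0
    · rw [← h0]
      refine le_of_tendsto (hcont0 y) ?_
      filter_upwards [Ioo_mem_nhdsGT (ht n).1] with σ hσ
      exact hnear n σ ⟨hσ.1, hσ.2.le⟩ y
    · exact hnear n τ ⟨h0, hτ.2⟩ y
  have hgauge' : ∀ n, ∀ τ ∈ Icc 0 (t n), ∀ y, lam' n * ‖u τ y‖ ≤ 1 := fun n τ hτ y => by
    calc lam' n * ‖u τ y‖ ≤ lam' n * (γ n * N n) := mul_le_mul_of_nonneg_left (hnear0 n τ hτ y) (hlam'0 n).le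
      _ = 1 := by rw [mul_left_comm, hlam'N, mul_inv_cancel₀ (hγ0 n).ne']
  have hnear' : Tendsto (fun n => lam' n * ‖u (t n) (x n)‖) atTop (𝓝 1) := by
    have h : ∀ n, lam' n * ‖u (t n) (x n)‖ = (γ n)⁻¹ := fun n => hlam'N n
    simp_rw [h]
    simpa using hγlim.inv₀ one_ne_zero
  -- ### a limit `W'` of the λ'-zoom along a further subsequence (part XX), and `W' = W` pointwise
  have hT2 : 0 < T / 2 := by positivity
  obtain ⟨ψ, W', hψ, hW', hconv'⟩ := innerLimit_exists_of_blowup_zoom hcl hE hbdd (tn := t ∘ φ)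
    (lamn := lam' ∘ φ) (xn := x ∘ φ) hT2 (fun k => ⟨(htn (φ k)).le, (ht (φ k)).2⟩) (fun k => hlam'0 (φ k))
    (hlam'lim.comp hφ.tendsto_atTop) (fun k => hgauge' (φ k)) (hnear'.comp hφ.tendsto_atTop)
  -- part XXXIX (datum-level every-limit alternative at ν = 1) on the λ'-data along `φ ∘ ψ`
  have hψφ : StrictMono (φ ∘ ψ) := hφ.comp hψ
  obtain ⟨d₀, Vv, hd₀, -, -, hWV, halt⟩ := innerLimit_alternative_of_every_zoom_limit_datum one_pos hT hmax hLH hdec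
    haxi hMₛ (tn := t ∘ φ ∘ ψ) (lamn := lam' ∘ φ ∘ ψ) (rn := fun k => cylRadius (x₀ (φ (ψ k))))
    (zn := fun k => x₀ (φ (ψ k)) 2) (t₁ := T / 2) hT2 (fun k => ⟨(htn (φ (ψ k))).le, (ht (φ (ψ k))).2⟩)
    (fun k => hlam'0 (φ (ψ k))) (hlam'lim.comp hψφ.tendsto_atTop) (fun k => cylRadius_nonneg _)
    (fun k τ hτ y => by rw [div_one]; exact hgauge' (φ (ψ k)) τ hτ y)
    (by
      refine (hnear'.comp hψφ.tendsto_atTop).congr fun k => ?_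
      simp only [Function.comp_apply, div_one, hx])
    (W' := W') (fun s hs => (hconv' s hs).congr fun k y => by simp only [Function.comp_apply, div_one, hx])
  -- `W' = W` on negative slices
  have hV'eq : ∀ n (s : ℝ) (y : ℝ³), (lam' n • stPull (lam' n ^ 2) (lam' n) (t n) (x n) u) s y =
      (γ n)⁻¹ • V n (s / γ n ^ 2) ((γ n)⁻¹ • y) := fun n s y => by
    have hγne : γ n ≠ 0 := (hγ0 n).ne'
    have e1 : t n + lam n ^ 2 * (s / γ n ^ 2) = t n + lam' n ^ 2 * s := by
      rw [hlam']; simp only; field_simp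
    have e2 : lam n * (γ n)⁻¹ = lam' n := by rw [hlam']; simp only; rw [div_eq_mul_inv]
    have e3 : (γ n)⁻¹ * lam n = lam' n := by rw [hlam']; simp only; rw [div_eq_inv_mul]
    rw [hV]
    simp only [Pi.smul_apply, stPull_apply, smul_smul]
    rw [e1, e2, e3]
  have hWeq : ∀ s < 0, ∀ y, W s y = W' s y := fun s hs y => by
    have h1 : Tendsto (fun k => V (φ (ψ k)) s y) atTop (𝓝 (W s y)) := (hpt s hs y).comp hψ.tendsto_atTop
    have h2 : Tendsto (fun k => ((lam' ∘ φ) (ψ k) • stPull ((lam' ∘ φ) (ψ k) ^ 2) ((lam' ∘ φ) (ψ k))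
        ((t ∘ φ) (ψ k)) ((x ∘ φ) (ψ k)) u) s y) atTop (𝓝 (W' s y)) :=
      ((hconv' s hs).tendstoLocallyUniformlyOn (s := univ)).tendsto_at (mem_univ y)
    have h4 := (zoom_rescale_compare hL V A B γ hAlim hB0 hVcont (fun n σ hσ z => (hVbd n σ hσ z).trans (hγ2 n))
      hVdiv hVmild (fun n => (hγ1 n).le) hγlim hs y).comp hψφ.tendsto_atTop
    have h5 : Tendsto (fun k => ((lam' ∘ φ) (ψ k) • stPull ((lam' ∘ φ) (ψ k) ^ 2) ((lam' ∘ φ) (ψ k))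
        ((t ∘ φ) (ψ k)) ((x ∘ φ) (ψ k)) u) s y) atTop (𝓝 (0 + W s y)) := by
      refine (h4.add h1).congr fun k => ?_
      simp only [Function.comp_apply]
      rw [hV'eq, sub_add_cancel]
    rw [zero_add] at h5
    exact tendsto_nhds_unique h5 h2
  -- ### assembly
  have hφn : ∀ n : ℕ, (n : ℝ) + 1 ≤ (φ n : ℝ) + 1 := fun n => by
    have h := hφ.id_le n
    have h' : (n : ℝ) ≤ (φ n : ℝ) := by exact_mod_cast h
    linarith
  refine ⟨t ∘ φ, x ∘ φ, W, fun n => ht (φ n), fun n => ⟨?_, ?_⟩, ?_, ?_, hWc, hW1, hWanc,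
    ⟨L, fun s hs => hvertex s hs⟩, fun s hs => ?_, ?_⟩
  · simp [hx]
  · simp [hx, cylRadius_nonneg]
  · -- blow-up of the levels
    have hb : Tendsto (fun n : ℕ => (n : ℝ) + 1) atTop atTop :=
      tendsto_natCast_atTop_atTop.atTop_add (tendsto_const_nhds (x := (1 : ℝ)))
    refine tendsto_atTop_mono (fun n => ?_) hb
    exact (hφn n).trans (hNn (φ n)).le
  · -- near-max with the factor `1 + 1/(n+1)`
    intro n σ hσ y
    have h1 : γ (φ n) ≤ 1 + 1 / ((n : ℝ) + 1) := by
      rw [hγ]; simp only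
      have h := one_div_le_one_div_of_le (by positivity : (0 : ℝ) < (n : ℝ) + 1) (hφn n)
      linarith
    calc ‖u σ y‖ ≤ γ (φ n) * N (φ n) := hnear (φ n) σ hσ y
      _ ≤ (1 + 1 / ((n : ℝ) + 1)) * N (φ n) := mul_le_mul_of_nonneg_right h1 (hN0 (φ n)).le
      _ = (1 + 1 / ((n : ℝ) + 1)) * ‖u ((t ∘ φ) n) ((x ∘ φ) n)‖ := by rw [hN]; rfl
  · -- convergence of the registered zoom = `V (φ n) s`
    refine (hloc s hs).congr fun n y => ?_
    rw [hV]
    simp only [Function.comp_apply, Pi.smul_apply, stPull_apply, hlam, hN]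
  · -- the dichotomy, read on `W = W'`
    rcases halt with ⟨c, hc1, -, -, hW'c⟩ | ⟨-, hVax, hVsw, -, ⟨s₁, hs₁, x₁, hx₁⟩, -⟩
    · exact Or.inl ⟨c, hc1, fun s hs y => by rw [hWeq s hs y]; exact hW'c s hs y⟩
    · have htrans : ∀ s < 0, (fun y => W s (y - d₀ • EuclideanSpace.single 0 1)) = Vv s := fun s hs => by
        funext y
        rw [hWeq s hs, hWV s hs, sub_add_cancel]
      refine Or.inr ⟨d₀, hd₀, fun s hs => ?_, fun s hs y => ?_, fun hall => ?_⟩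
      · rw [htrans s hs]; exact hVax s hs
      · rw [htrans s hs]
        have h := hVsw s hs y
        rwa [div_one] at h
      · have h := hall s₁ hs₁ x₁
        rw [htrans s₁ hs₁] at h
        exact hx₁ h


/-- **Registered stub `zoom_dichotomy_of_isMaximalSmoothSolution`** (verbatim signature): the KNSS sup-zoom of a witness of
`CertifiedBlowupAxisymBlowup` at meridional near-max points converges along the returned sequence to a bounded ancient mild
solution `W`, `|W| ≤ 1`, `1 − L|s| ≤ ‖W(s,0)‖`, which is EITHER a unit constant OR has an axisymmetric translate with bounded,
not identically vanishing swirl. `zoom_dichotomy_core` with `zoom_window_lipschitz`.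
[cite: KochNadirashviliSereginSverak2009, §6 Prop. 6.1 / Lemma 6.1 with §4] -/
theorem zoom_dichotomy_of_isMaximalSmoothSolution : ∀ {T : ℝ} {u : ℝ → ℝ³ → ℝ³} {p : ℝ → ℝ³ → ℝ}, 0 < T → IsMaximalSmoothSolution 1 0 u p T → IsLerayHopfOn T 1 0 (u 0) u → HasRapidSpatialDecay (u 0) → IsAxisymmetric (u 0) → ∃ (t : ℕ → ℝ) (x : ℕ → ℝ³) (W : ℝ → ℝ³ → ℝ³), (∀ n, t n ∈ Ioo 0 T) ∧ (∀ n, x n 1 = 0 ∧ 0 ≤ x n 0) ∧ Tendsto (fun n => ‖u (t n) (x n)‖) atTop atTop ∧ (∀ n, ∀ s ∈ Ioc 0 (t n), ∀ y, ‖u s y‖ ≤ (1 + 1 / ((n : ℝ) + 1)) * ‖u (t n) (x n)‖) ∧ ContinuousOn (uncurry W) (Iio 0 ×ˢ univ) ∧ (∀ s < 0, ∀ y, ‖W s y‖ ≤ 1) ∧ IsBoundedAncientMildSolution 1 W ∧ (∃ L : ℝ, ∀ s ∈ Ioo (-1 : ℝ) 0, 1 - L * |s| ≤ ‖W s 0‖)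 ∧ (∀ s < 0, TendstoLocallyUniformly (fun n (y : ℝ³) => ‖u (t n) (x n)‖⁻¹ • u (t n + ‖u (t n) (x n)‖⁻¹ ^ 2 * s) (x n + ‖u (t n) (x n)‖⁻¹ • y)) (W s) atTop) ∧ ((∃ b : ℝ³, ‖b‖ = 1 ∧ ∀ s < 0, ∀ y, W s y = b) ∨ (∃ d : ℝ, 0 ≤ d ∧ (∀ s < 0, IsAxisymmetric fun y => W s (y - d • EuclideanSpace.single 0 1)) ∧ (∀ s < 0, ∀ y, |swirl (fun y => W s (y - d • EuclideanSpace.single 0 1)) y| ≤ ⨆ z, |swirl (u 0) z|) ∧ ¬ ∀ s < 0, HasNoSwirl fun y => W s (y - d • EuclideanSpace.single 0 1))) := by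
  obtain ⟨L, hL0, hL⟩ := zoom_window_lipschitz
  intro T u p hT hmax hLH hdec haxi
  exact zoom_dichotomy_core hL0 hL hT hmax hLH hdec haxi

end Summit.NavierStokesRegularity.NavierStokesRegularity.Theorems.CertifiedBlowupAxisymBlowup.CompactAmplification
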